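import Mathlib.Tactic

/-!
# B4ParityBasepoints — kernel half of the d2-α parity theorem (plan-lens-HodgeAV-embed-2 g0, 2026-08-29)

Memo: `Cruxes/BlochSeedDiscOne/D2ALPHA-PARITY-BASEPOINTS-embed2-g0.md`.  Frame P = B₄ × B̄₄, B = B₄ = ℂ⁴/Φ(ℤ[ζ₁₆]), principal
polarisation E(a,b) = (1/8)·Tr(ξ₀ ā b), ξ₀ = ζ⁴(θ² − θ − 1), θ = ζ + ζ⁻¹.  The sixteen open BOX-4 classes Δ_u = (2,2;(1+i)u) = N_u + N_{iu}
= q*(Θ ⊠ Θ) have Bs|Δ_u| = q⁻¹(⋂_{t ∈ W} [(Θ − t) × B ∪ B × (Θ − θt)]), W = B[𝔭⁴] ⊂ B[2], θ ∈ {id, conj}.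

PEN INPUTS (not formalised here): (a) B[2] = O/2O ≅ 𝔽₂⁸ via bit j ↔ ζʲ, and the Weil pairing is ⟨ζᵃ, ζᵇ⟩ = E(ζᵃ, ζᵇ) mod 2
= ±(coefficient of ζ^{(a−b) mod 8} in ξ₀) mod 2 (because Tr_{L/ℚ} ζᵏ = 8·[16 ∣ k] up to the sign from ζ⁸ = −1); (b) Mumford, *On the
equations defining abelian varieties I*, §2 Prop. 2: for a symmetric theta divisor, z ↦ mult_z Θ mod 2 on B[2] is an affine refinement
m(z) = Q(z) + ⟨κ, z⟩ + c of the Weil pairing; (c) odd multiplicity ⇒ the point lies on Θ.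

KERNEL CONTENT (all by `decide` from the eight coefficients of ξ₀): the pairing is alternating; W = (1+ζ⁴)·𝔽₂⁸ = {v + 16v} is LAGRANGIAN
(isotropic and equal to its own orthogonal); `Q` below is a quadratic refinement of the pairing, additive and non-zero on W; and the MAIN
statements: for EVERY affine refinement m = Q + ⟨κ,·⟩ + c (all 512) and EVERY t ∈ W, one of the two 2-torsion points κ + t, κ + (1+ζ⁴) + θ(t)
has m = 1 (odd multiplicity), for θ = id and θ = complex conjugation.  With (b),(c): (κ, κ + 1 + ζ⁴) ∈ B × B lies on all sixteen divisors, so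
q⁻¹(κ, κ+1+ζ⁴) ⊂ Bs|Δ_u| ≠ ∅: the sixteen classes are NOT base-point-free.

Nothing here is a statement about HC, HC_AV, HC_CM, H2 or `stmt-HodgeConjecture-18881`.
-/

namespace Summit.HodgeConjecture.HodgeConjecture.Cruxes.BlochSeedDiscOne.B4ParityBasepoints

/-- coefficients of `ξ₀ = ζ⁴(θ² − θ − 1)` on `ζ⁰ … ζ⁷` (θ = ζ − ζ⁷). -/
def xi0 : Fin 8 → ℤ := ![0, 0, 1, -1, 1, -1, 1, 0]

/-- Weil pairing mod 2 on basis vectors: `⟨ζᵃ, ζᵇ⟩ = ξ₀[(a − b) mod 8] mod 2` (`Fin 8` subtraction is mod 8). -/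
def gram (a b : Fin 8) : Bool := xi0 (a - b) % 2 != 0

/-- bit `j` of `x < 256` = coefficient of `ζʲ` of the 2-torsion point. -/
def bit (x : ℕ) (j : Fin 8) : Bool := x.testBit j.val

/-- the symplectic form `⟨x, y⟩` on `𝔽₂⁸` (bilinear extension of `gram`). -/
def sp (x y : ℕ) : Bool :=
  (List.finRange 8).foldl (fun acc a => (List.finRange 8).foldl (fun acc2 b => acc2 ^^ (bit x a && bit y b && gram a b)) acc) false

/-- a quadratic refinement: `Q(x) = Σ_{a<b} x_a x_b gram a b` (upper-triangular part; the diagonal of `gram` is zero). -/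
def Q (x : ℕ) : Bool :=
  (List.finRange 8).foldl (fun acc a => (List.finRange 8).foldl
    (fun acc2 b => acc2 ^^ (decide (a.val < b.val) && bit x a && bit x b && gram a b)) acc) false

/-- the general affine refinement `m = Q + ⟨κ, ·⟩ + c` (the parity function of some symmetric theta divisor, up to the pen inputs). -/
def m (κ : ℕ) (c : Bool) (z : ℕ) : Bool := Q z ^^ sp κ z ^^ c

/-- `W = B[𝔭⁴] = (1 + ζ⁴)·O mod 2 = {v + 16 v : v < 16}` (low nibble = high nibble). -/
def W : List ℕ := (List.range 16).map (fun v => v + 16 * v)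

/-- complex conjugation `ζʲ ↦ ζ^{−j} ≡ ζ^{(8−j) mod 8}` (mod 2 the sign is invisible) as a bit permutation. -/
def conj8 (t : ℕ) : ℕ := (List.finRange 8).foldl (fun acc j => if bit t j then acc ||| (1 <<< ((8 - j.val) % 8)) else acc) 0

/-- the pairing is alternating (zero diagonal, symmetric mod 2). -/
theorem gram_alternating : (∀ a : Fin 8, gram a a = false) ∧ (∀ a b : Fin 8, gram a b = gram b a) := by decide +kernel

/-- `W` is totally isotropic … -/
theorem W_isotropic : ∀ s ∈ W, ∀ t ∈ W, sp s t = false := by decide +kernel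

/-- … and equal to its orthogonal: LAGRANGIAN (|W| = 16 = 2⁴ in 𝔽₂⁸). -/
theorem W_lagrangian : ∀ x < 256, (∀ t ∈ W, sp x t = false) → x ∈ W := by decide +kernel

/-- conjugation preserves `W`. -/
theorem conj_W : ∀ t ∈ W, conj8 t ∈ W := by decide +kernel

/-- `Q` is additive on the Lagrangian `W` and not identically zero there. -/
theorem Q_on_W : (∀ s ∈ W, ∀ t ∈ W, Q (s ^^^ t) = (Q s ^^ Q t)) ∧ (∃ t ∈ W, Q t = true) := by decide +kernel

/-- `Q` refines the pairing on generators: `Q(x + ζʲ) = Q(x) + Q(ζʲ) + ⟨x, ζʲ⟩` for all `x < 256` and all basis vectors `ζʲ`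
(2048 cases; the identity for general `y` follows by induction on the bits of `y` using bilinearity of `sp` — pen, one line). -/
theorem Q_refines_basis : ∀ x < 256, ∀ j : Fin 8, Q (x ^^^ (1 <<< j.val)) = (Q x ^^ Q (1 <<< j.val) ^^ sp x (1 <<< j.val)) := by decide +kernel

/-- MAIN (θ = id): for every affine parity function and every `t ∈ W`, one of `κ + t`, `κ + (1+ζ⁴) + t` is odd. -/
theorem main_id : ∀ κ < 256, ∀ c : Bool, ∀ t ∈ W, (m κ c (κ ^^^ t) || m κ c (κ ^^^ 17 ^^^ t)) = true := by decide +kernel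

/-- MAIN (θ = conj): the same with the second point read through complex conjugation on `W`. -/
theorem main_conj : ∀ κ < 256, ∀ c : Bool, ∀ t ∈ W, (m κ c (κ ^^^ t) || m κ c (κ ^^^ 17 ^^^ conj8 t)) = true := by decide +kernel

/-- the pairing mod 2 is non-degenerate on `𝔽₂⁸` (det E = 1): every non-zero `x` pairs non-trivially with some basis vector. -/
theorem sp_nondegenerate : ∀ x < 256, x ≠ 0 → ∃ j : Fin 8, sp x (1 <<< j.val) = true := by decide +kernel

/-- `#{Q = 1} = 136` on `𝔽₂⁸` (so this particular refinement has Arf invariant 1; the MAIN statements quantify over all 512 affine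
refinements, so the Arf invariant of the actual theta characteristic is irrelevant). -/
theorem Q_count : ((List.range 256).filter (fun x => Q x)).length = 136 := by decide +kernel

end Summit.HodgeConjecture.HodgeConjecture.Cruxes.BlochSeedDiscOne.B4ParityBasepoints
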